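import Summits.CriticalPhenomena.PercolationContinuityZ3.Theorems.SahiRandomClusterLimits
import Summits.CriticalPhenomena.PercolationContinuityZ3.Theorems.SahiIsingTwoFreeSlots

/-!
# Sahi's Theorem 2 with two free NON-LOCAL slots for box-TP₂ laws of random SETS; the limit random-cluster measures
# `φ^b_{p,q}` of `ℤ^d`: `E_n({F_1 open},…,{F_{n−2} open}, f, g) ≥ 0` UNCONDITIONALLY for arbitrary measurable
# increasing `f, g`

Support file of the Sahi cell (`prim-sahi`, typer seat, generation 16; `--supports stmt-CriticalPhenomena-4575`).
Theorems only (no definitions, no named facts, no sorries).  Transport of generation 15's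
`msahiE_nonneg_offTwo_of_isBoxTP2` (box-TP₂ probability measures on `{−1,+1}^ι`, `ι` countably infinite: `E_n ≥ 0`
when at most two slots are arbitrary bounded measurable nonnegative increasing functionals and the others are
indicators of all-plus cylinders) along the measurable order isomorphism `Set ι ≃o {−1,+1}^ι`:

* `isBoxTP2_map_orderIso` — box-TP₂ is transported along measurable order isomorphisms (plumbing);
* **`msahiE_nonneg_openEdges_offTwo_of_isBoxTP2_set`** — for a box-TP₂ probability measure on `Set ι` (`ι` countably
  infinite; boxes `{x | a ⊆ x ⊆ b}`) and every `n`: **`0 ≤ E_n(f_0,…,f_{n−1})` whenever at most two slots are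
  arbitrary bounded measurable nonnegative `⊆`-monotone functionals and every other slot is the indicator
  `1_{F_i ⊆ ω}` of "all elements of the finite set `F_i` are present"** (Sahi 2008 Thm. 2 / Blinovsky's cumulations,
  two free slots, no locality); `sahiE3_openEdges_nonneg_of_isBoxTP2_set` — `n = 3` displayed:
  `0 ≤ 2μ(O_F ∩ B ∩ C) + μ(O_F)μ(B)μ(C) − μ(O_F)μ(B ∩ C) − μ(B)μ(O_F ∩ C) − μ(C)μ(O_F ∩ B)` for ARBITRARY measurable
  increasing events `B, C`.
* THE LIMIT RANDOM-CLUSTER MEASURES (`IsRandomClusterLimit d b p q P`, `0 ≤ p ≤ 1`, `q ≥ 1`, generation 16's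
  `isRandomClusterLimit_isBoxTP2`): **`isRandomClusterLimit_msahiE_nonneg_openEdges_offTwo`**,
  **`isRandomClusterLimit_sahiE3_openEdges_nonneg`** — e.g. `0 ≤ E_3({F open}, {x ↔ ∞}, {y ↔ ∞})` under `φ^b_{p,q}`
  (`isRandomClusterLimit_sahiE3_openEdges_percolatesAt`), UNCONDITIONALLY (no `C_n`), in infinite volume, for
  non-local events — the infinite-volume FK version of generation 9's finite-volume `rcMeasure_sahiE3_openEdges_nonneg`.

No sorries, no new axioms.
-/

noncomputable section

namespace Summit.CriticalPhenomena.PercolationContinuityZ3.Theorems.SahiBoxTP2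

open MeasureTheory Set Filter Topology Function Literature.Combinatorics.Sahi2008
open Literature.Probability.LatticeModels Literature.Probability.Percolation
open scoped ENNReal

/-! ### Transport of box-TP₂ and of `E_n` along `Set ι ≃o {−1,+1}^ι` -/

section Transport

variable {ι : Type*}

/-- **Box-TP₂ is transported along measurable order isomorphisms.** [this work] -/
theorem isBoxTP2_map_orderIso {X Y : Type*} [Lattice X] [Lattice Y] [MeasurableSpace X] [MeasurableSpace Y]
    (Φ : X ≃o Y) (hΦ : Measurable Φ) (hIcc : ∀ a b : Y, MeasurableSet (Icc a b)) {μ : Measure X}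
    (h : IsBoxTP2 μ) : IsBoxTP2 (μ.map Φ) := by
  intro a b a' b'
  simp only [Measure.map_apply hΦ (hIcc _ _), OrderIso.preimage_Icc, OrderIso.map_inf, OrderIso.map_sup]
  exact h _ _ _ _

variable [Countable ι] [Infinite ι]

/-- **Sahi's Theorem 2 with two free non-local slots for box-TP₂ laws of random sets** (`ι` countably infinite):
`0 ≤ E_n(f_0,…,f_{n−1})` whenever at most two slots are arbitrary bounded measurable nonnegative `⊆`-monotone
functionals and every other slot is an indicator `1_{F_i ⊆ ω}` (`F_i` finite). [this work] -/
theorem msahiE_nonneg_openEdges_offTwo_of_isBoxTP2_set (μ : Measure (Set ι)) [IsProbabilityMeasure μ]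
    (hμ : IsBoxTP2 μ) {n : ℕ} (f : Fin n → Set ι → ℝ) (I : Finset (Fin n)) (hI : I.card ≤ 2)
    (hfm : ∀ i ∈ I, Measurable (f i)) (hf0 : ∀ i ∈ I, ∀ ω, 0 ≤ f i ω) {B : ℝ} (hfB : ∀ i ∈ I, ∀ ω, f i ω ≤ B)
    (hmono : ∀ i ∈ I, Monotone (f i)) (F : Fin n → Finset ι)
    (hcum : ∀ i, i ∉ I → f i = {ω : Set ι | ↑(F i) ⊆ ω}.indicator 1) : 0 ≤ msahiE μ n f := by
  classical
  -- the measurable order isomorphism `Set ι ≃o (ι → ℤˣ)`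
  set M : (ι → ℤˣ) ≃ᵐ (ι → Bool) := MeasurableEquiv.piCongrRight fun _ : ι => unitsIntEquivBool with hM
  set Ψ : (ι → Bool) ≃o (ι → ℤˣ) :=
    M.symm.toEquiv.toOrderIso (fun x y hxy => piCongrRight_unitsIntEquivBool_symm_mono hxy)
      (fun x y hxy => piCongrRight_unitsIntEquivBool_mono hxy) with hΨ
  set Φ : Set ι ≃o (ι → ℤˣ) := (setBoolIso (ι := ι)).trans Ψ with hΦ
  have hΦm : Measurable Φ := by
    change Measurable (fun x => M.symm (setBoolIso x))
    exact M.symm.measurable.comp measurable_setBoolIso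
  have hΦsm : Measurable Φ.symm := by
    change Measurable (fun u => (setBoolIso (ι := ι)).symm (M u))
    exact measurable_setBoolIso_symm.comp M.measurable
  have hΦe : MeasurableEmbedding Φ.symm :=
    { injective := Φ.symm.injective
      measurable := hΦsm
      measurableSet_image' := fun s hs => by
        rw [OrderIso.image_eq_preimage_symm, OrderIso.symm_symm]
        exact hΦm hs }
  haveI : IsProbabilityMeasure (μ.map Φ) := Measure.isProbabilityMeasure_map hΦm.aemeasurable
  have hpres : MeasurePreserving Φ.symm (μ.map Φ) μ := by
    refine ⟨hΦsm, ?_⟩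
    rw [Measure.map_map hΦsm hΦm]
    have : (Φ.symm ∘ Φ : Set ι → Set ι) = id := funext fun x => Φ.symm_apply_apply x
    rw [this, Measure.map_id]
  have hbox : IsBoxTP2 (μ.map Φ) := isBoxTP2_map_orderIso Φ hΦm measurableSet_Icc_spinConfig hμ
  rw [← msahiE_comp_measurePreserving hpres hΦe n f]
  -- the transported slots
  have hsymm : ∀ (σ : ι → ℤˣ) (v : ι), v ∈ Φ.symm σ ↔ σ v = 1 := fun σ v => by
    change v ∈ (setBoolIso (ι := ι)).symm (M σ) ↔ σ v = 1
    rw [setBoolIso_symm_apply, mem_setOf_eq]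
    change decide (σ v = 1) = true ↔ σ v = 1
    exact decide_eq_true_iff
  refine msahiE_nonneg_offTwo_of_isBoxTP2 (μ.map Φ) hbox (fun i => f i ∘ Φ.symm) I hI
    (fun i hi => (hfm i hi).comp hΦsm) (fun i hi σ => hf0 i hi _) (fun i hi σ => hfB i hi _)
    (fun i hi σ τ hστ => hmono i hi (Φ.symm.monotone hστ)) F fun i hi => ?_
  rw [hcum i hi]
  funext σ
  simp only [Function.comp_apply, Set.indicator_apply, mem_setOf_eq, Pi.one_apply]
  have e : (↑(F i) ⊆ Φ.symm σ) ↔ ∀ v ∈ F i, σ v = 1 :=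
    ⟨fun h v hv => (hsymm σ v).1 (h (Finset.mem_coe.2 hv)), fun h v hv => (hsymm σ v).2 (h v (Finset.mem_coe.1 hv))⟩
  simp only [e]

/-- **`n = 3` displayed**: for a box-TP₂ probability measure on `Set ι`, a finite `F` and ARBITRARY measurable
`⊆`-increasing events `B, C`:
`0 ≤ 2μ(O_F ∩ B ∩ C) + μ(O_F)μ(B)μ(C) − μ(O_F)μ(B ∩ C) − μ(B)μ(O_F ∩ C) − μ(C)μ(O_F ∩ B)`, `O_F = {F ⊆ ω}`.
[this work] -/
theorem sahiE3_openEdges_nonneg_of_isBoxTP2_set (μ : Measure (Set ι)) [IsProbabilityMeasure μ] (hμ : IsBoxTP2 μ)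
    (F : Finset ι) {B C : Set (Set ι)} (hBm : MeasurableSet B) (hB : IsUpperSet B) (hCm : MeasurableSet C)
    (hC : IsUpperSet C) : 0 ≤ sahiE3 μ {ω : Set ι | ↑F ⊆ ω} B C := by
  have hOm : MeasurableSet {ω : Set ι | ↑F ⊆ ω} := by
    have e : {ω : Set ι | ↑F ⊆ ω} = ⋂ i ∈ F, {ω : Set ι | i ∈ ω} := by
      ext ω
      simp only [mem_setOf_eq, mem_iInter]
      exact ⟨fun h i hi => h (Finset.mem_coe.2 hi), fun h i hi => h i (Finset.mem_coe.1 hi)⟩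
    rw [e]
    exact MeasurableSet.biInter (Finset.countable_toSet F) fun i _ => measurableSet_mem i
  rw [← msahiE_three_indicator _ hOm hBm hCm]
  have hind : ∀ {S : Set (Set ι)} (ω : Set ι), 0 ≤ S.indicator (1 : Set ι → ℝ) ω ∧
      S.indicator (1 : Set ι → ℝ) ω ≤ 1 := fun {S} ω => by
    by_cases h : ω ∈ S
    · simp [Set.indicator_of_mem h]
    · simp [Set.indicator_of_notMem h]
  refine msahiE_nonneg_openEdges_offTwo_of_isBoxTP2_set μ hμ _ {1, 2} (by decide) ?_ ?_ (B := 1) ?_ ?_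
    ![F, ∅, ∅] ?_
  · intro i hi
    fin_cases hi
    · exact measurable_const.indicator hBm
    · exact measurable_const.indicator hCm
  · intro i hi ω
    fin_cases hi
    · exact (hind ω).1
    · exact (hind ω).1
  · intro i hi ω
    fin_cases hi
    · exact (hind ω).2
    · exact (hind ω).2
  · intro i hi
    fin_cases hi
    · exact (indicator_one_props hB hBm).1
    · exact (indicator_one_props hC hCm).1
  · intro i hi
    fin_cases i
    · rfl
    · exact absurd (by decide) hi
    · exact absurd (by decide) hi

end Transport

/-! ### The limit random-cluster measures of `ℤ^d` -/

section Limit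

variable {d : ℕ} {b : RCBoundary} {p q : ℝ} {P : Measure (BondConfig (Site d))}

/-- **Sahi's Theorem 2 with two free non-local slots for `φ^b_{p,q}`, UNCONDITIONALLY**: `0 ≤ E_n(f_0,…,f_{n−1})`
whenever at most two slots are arbitrary bounded measurable nonnegative increasing functionals of the infinite bond
configuration and the others are indicators `1_{F_i open}`. [this work] -/
theorem isRandomClusterLimit_msahiE_nonneg_openEdges_offTwo (hP : IsRandomClusterLimit d b p q P)
    (hp : p ∈ Set.Icc (0 : ℝ) 1) (hq : 1 ≤ q) (e : Sym2 (Site d) ≃ ℕ) {n : ℕ}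
    (f : Fin n → BondConfig (Site d) → ℝ) (I : Finset (Fin n)) (hI : I.card ≤ 2) (hfm : ∀ i ∈ I, Measurable (f i))
    (hf0 : ∀ i ∈ I, ∀ ω, 0 ≤ f i ω) {B : ℝ} (hfB : ∀ i ∈ I, ∀ ω, f i ω ≤ B) (hmono : ∀ i ∈ I, Monotone (f i))
    (F : Fin n → Finset (Sym2 (Site d))) (hcum : ∀ i, i ∉ I → f i = {ω : BondConfig (Site d) | ↑(F i) ⊆ ω}.indicator 1) :
    0 ≤ msahiE P n f := by
  haveI := hP.isProbabilityMeasure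
  haveI : Infinite (Sym2 (Site d)) := Infinite.of_injective e.symm e.symm.injective
  exact msahiE_nonneg_openEdges_offTwo_of_isBoxTP2_set P (isRandomClusterLimit_isBoxTP2 hP hp hq e) f I hI hfm hf0
    hfB hmono F hcum

/-- **`0 ≤ E_3({F open}, B, C)` under `φ^b_{p,q}` for ARBITRARY measurable increasing events `B, C`** of the infinite
configuration. [this work] -/
theorem isRandomClusterLimit_sahiE3_openEdges_nonneg (hP : IsRandomClusterLimit d b p q P) (hp : p ∈ Set.Icc (0 : ℝ) 1)
    (hq : 1 ≤ q) (e : Sym2 (Site d) ≃ ℕ) (F : Finset (Sym2 (Site d))) {B C : Set (BondConfig (Site d))}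
    (hBm : MeasurableSet B) (hB : IsUpperSet B) (hCm : MeasurableSet C) (hC : IsUpperSet C) :
    0 ≤ sahiE3 P {ω : BondConfig (Site d) | ↑F ⊆ ω} B C := by
  haveI := hP.isProbabilityMeasure
  haveI : Infinite (Sym2 (Site d)) := Infinite.of_injective e.symm e.symm.injective
  exact sahiE3_openEdges_nonneg_of_isBoxTP2_set P (isRandomClusterLimit_isBoxTP2 hP hp hq e) F hBm hB hCm hC

/-- **`0 ≤ E_3({F open}, {x ↔ ∞}, {y ↔ ∞})` under `φ^b_{p,q}`** — two non-local percolation events. [this work] -/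
theorem isRandomClusterLimit_sahiE3_openEdges_percolatesAt (hP : IsRandomClusterLimit d b p q P)
    (hp : p ∈ Set.Icc (0 : ℝ) 1) (hq : 1 ≤ q) (e : Sym2 (Site d) ≃ ℕ) (F : Finset (Sym2 (Site d))) (x y : Site d) :
    0 ≤ sahiE3 P {ω : BondConfig (Site d) | ↑F ⊆ ω} (percolatesAt x) (percolatesAt y) :=
  isRandomClusterLimit_sahiE3_openEdges_nonneg hP hp hq e F (measurableSet_percolatesAt_holds x)
    (isUpperSet_percolatesAt x) (measurableSet_percolatesAt_holds y) (isUpperSet_percolatesAt y)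

end Limit

end Summit.CriticalPhenomena.PercolationContinuityZ3.Theorems.SahiBoxTP2
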